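import Literature.AnabelianGeometry.SemiGraphs.PSCCoveringMapAlongProofs
import Literature.AnabelianGeometry.SemiGraphs.PSCCoveringBranchDataProofs
import Literature.AnabelianGeometry.SemiGraphs.PSCCompactificationTransfer
import Literature.AnabelianGeometry.SemiGraphs.PSCConjClassLevelwiseProofs
import Literature.AnabelianGeometry.SemiGraphs.PSCCoveringDescentProofs
import Literature.AnabelianGeometry.AbsoluteAnabelian.LocalReciprocityCofinal
import HarnessLib

/-!
# [CombGC] Theorem 1.6 (i) for general `Σ`, part 1: pro-`l` shadows of cuspidal subgroups and the
# stabilizers of cusps ("we may assume `Σ = {l}`")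

Mochizuki, *A combinatorial version of the Grothendieck conjecture*, Tohoku Math. J. **59** (2007)
[CombGC], proof of Theorem 1.6 (i), author's ms p. 13 l.−9…−4: "First, we observe that by Proposition
1.2, (ii), cuspidal edge-like subgroups may be recovered as the stabilizers of cusps of finite étale
coverings of `G`, `H`.  Thus, … we may assume that `Σ = {l}`."  Sub-DAG row **T16-L04 (b)(c)(d)** of the
abc-iut cell (`plan/L3/SUBDAG-CombGC-Thm16.md`, writer abc-iut-w4-d052 RULINGS v5 (5); (a) = the data
`PSCDatum.mapAlong` / `IsMaxProSigmaQuotient` of abc-iut-L3-t4, `PSCCoveringMapAlong*.lean`).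

For an open normal `U ≤ Π_G` (covering datum `G_U = G.restrictBD U hU bd` over `↥U`, abc-iut-L3-t4)
and a presentation `f : ↥U ↠ Q` of the maximal pro-`l` quotient of `↥U`, write `D_U := G_U.mapAlong f`
(the "pro-`l` `G_U`", `Σ = {l}`) and, for a subgroup `C ≤ Π_G`, `Sh C := f(U ∩ C) ≤ Q` (its "shadow").

* **(b)** `IsNumericallyCuspidal.mapAlong` — numerical cuspidality passes from `β : A ≅ A'` to the
  isomorphism `β̄ : Q ≅ Q'` it induces on maximal pro-`S` quotients (`mapAlong_cuspCount`, t4);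
* **(c)** `exists_smul_eq_of_map_conj` — Prop. 1.2 (i) for `D_U` (`EdgeLikeOpenInterDeterminesEdge`)
  makes the shadow remember the cusp: `Sh(g•C)` `Q`-conjugate to `Sh C` forces `U ∩ g•C = U ∩ u•C` for
  some `u ∈ U`; with Prop. 1.2 (ii) (`VerticialEdgeLikeCommensurablyTerminal`) this is `g ∈ U·C`:
  **`mem_sup_iff_shadow_conj`** — the stabilizer `U ⊔ C` of the cusp of `G_U` under `C` is READ on the
  pro-`l` shadows ("recovered as the stabilizers of cusps of finite étale coverings");
* `exists_shadow_conj_equiv` — conjugation by `g ∈ Π_G` descends to the maximal pro-`l` quotient of `U`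
  (its kernel is topologically characteristic, t4's `map_ker_eq`), acting on shadows.
Part 2 (`PSCProLCuspidalProofs.lean`) combines these with abc-iut-w4-d052's {l}-kernel and
abc-iut-w5-d188's level-wise criterion into Thm. 1.6 (i) necessity for general `Σ`.

Proof-only; no new definitions or Prop facts; nothing here takes a side on [IUTchIII] Cor. 3.12.
[cite: MochizukiCombGC2007, Thm 1.6(i) p.13]
-/

noncomputable section

namespace Literature.AnabelianGeometry.SemiGraphs

namespace PSCDatum

open scoped Pointwise
open PSCCovering

universe u

/-! ### (b) Numerical cuspidality along presentations of quotients -/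

section NumAlong

variable {A : Type u} [Group A] [TopologicalSpace A] [CompactSpace A]
variable {A' : Type u} [Group A'] [TopologicalSpace A'] [CompactSpace A']
variable {Q : Type u} [Group Q] [TopologicalSpace Q] [T2Space Q]
variable {Q' : Type u} [Group Q'] [TopologicalSpace Q'] [T2Space Q']
variable (E : PSCDatum A) (E' : PSCDatum A') {β : A ≃ₜ* A'}

/-- **Def. 1.4 (ii) passes to the image data along compatible presentations** ("we may assume
`Σ = {l}`"): if `β : Π_E ≅ Π_{E'}` is numerically cuspidal, `f : Π_E ↠ Q`, `f' : Π_{E'} ↠ Q'` are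
continuous surjections with `β(ker f) = ker f'` and `β̄ : Q ≅ Q'` lies over `β`, then `β̄` is numerically
cuspidal for the image data (the coverings of `E.mapAlong f` are the coverings of `E` containing `ker f`,
with the same cusps, `mapAlong_cuspCount`). [cite: MochizukiCombGC2007, Thm 1.6(i) p.13] -/
theorem IsNumericallyCuspidal.mapAlong (f : A →* Q) (hf : Continuous f) (S : Set ℕ)
    (hS : S ⊆ E.Sigma) (hne : S.Nonempty) (hQ : IsProSigma S Q) (f' : A' →* Q') (hf' : Continuous f')
    (S' : Set ℕ) (hS' : S' ⊆ E'.Sigma) (hne' : S'.Nonempty) (hQ' : IsProSigma S' Q')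
    (hs : Function.Surjective f) (hs' : Function.Surjective f')
    (hker : f.ker.map β.toMulEquiv.toMonoidHom = f'.ker) {β' : Q ≃ₜ* Q'}
    (hβ' : ∀ a : A, β' (f a) = f' (β a)) (h : E.IsNumericallyCuspidal E' β) :
    (E.mapAlong f hf S hS hne hQ).IsNumericallyCuspidal (E'.mapAlong f' hf' S' hS' hne' hQ') β' := by
  intro W hW
  -- `W = f(W₀)` with `W₀ ⊇ ker f` open
  set W₀ : Subgroup A := W.comap f with hW₀
  have hW₀o : IsOpen (W₀ : Set A) := hW.preimage hf
  have hkW₀ : f.ker ≤ W₀ := fun x hx => by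
    rw [hW₀, Subgroup.mem_comap, (MonoidHom.mem_ker).mp hx]; exact W.one_mem
  have hWeq : W = W₀.map f := (Subgroup.map_comap_eq_self_of_surjective hs W).symm
  have hkW₀' : f'.ker ≤ W₀.map β.toMulEquiv.toMonoidHom := by
    rw [← hker]; exact Subgroup.map_mono hkW₀
  rw [hWeq, map_map_eq_of_over hβ', E.mapAlong_cuspCount f hf S hS hne hQ hs hkW₀,
    E'.mapAlong_cuspCount f' hf' S' hS' hne' hQ' hs' hkW₀']
  exact h W₀ hW₀o

end NumAlong

/-! ### (c) The shadow of a cuspidal subgroup in the pro-`l` covering datum remembers the cusp -/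

section Shadow

variable {A : Type u} [Group A] [TopologicalSpace A] [CompactSpace A]
variable {Q : Type u} [Group Q] [TopologicalSpace Q] [T2Space Q]
variable (E : PSCDatum A)

/-- Prop. 1.2 (i) (edge-like case) for the image datum separates the images of NON-conjugate cuspidal
subgroups: if `f(X₁)` and `f(X₂)` are `Q`-conjugate for cuspidal `X₁`, `X₂` of `E`, then `X₁`, `X₂` are
conjugate in `Π_E`. [cite: MochizukiCombGC2007, Prop 1.2(i) p.8] -/
theorem exists_smul_eq_of_map_conj (f : A →* Q) (hf : Continuous f) (S : Set ℕ) (hS : S ⊆ E.Sigma)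
    (hne : S.Nonempty) (hQ : IsProSigma S Q)
    (hD : (E.mapAlong f hf S hS hne hQ).EdgeLikeOpenInterDeterminesEdge) {X₁ X₂ : Subgroup A}
    (h₁ : E.IsCuspidal X₁) (h₂ : E.IsCuspidal X₂) {q : ConjAct Q} (h : X₁.map f = q • X₂.map f) :
    ∃ δ : ConjAct A, X₁ = δ • X₂ := by
  obtain ⟨d₁, δ₁, rfl⟩ := h₁
  obtain ⟨d₂, δ₂, rfl⟩ := h₂
  -- the images are conjugates of the cuspidal subgroups `f(Π_d)` of the image datum
  rw [map_conj_smul, map_conj_smul, smul_smul] at h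
  have hd : (Sum.inr d₁ : E.graph.N ⊕ E.graph.C) = Sum.inr d₂ := by
    refine hD (Sum.inr d₁) (Sum.inr d₂) (ConjAct.toConjAct (f (ConjAct.ofConjAct δ₁)))
      (q * ConjAct.toConjAct (f (ConjAct.ofConjAct δ₂))) ?_
    have he : ∀ d : E.graph.C, (E.mapAlong f hf S hS hne hQ).edgeGp (Sum.inr d) = (E.cuspGp d).map f :=
      fun d => rfl
    rw [he, he, ← h, inf_idem]
    have : ((ConjAct.toConjAct (f (ConjAct.ofConjAct δ₁)) • (E.cuspGp d₁).map f).subgroupOf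
        (ConjAct.toConjAct (f (ConjAct.ofConjAct δ₁)) • (E.cuspGp d₁).map f) :
          Subgroup (ConjAct.toConjAct (f (ConjAct.ofConjAct δ₁)) • (E.cuspGp d₁).map f :
            Subgroup Q)) = ⊤ := Subgroup.subgroupOf_self _
    rw [this, Subgroup.coe_top]
    exact isOpen_univ
  cases Sum.inr_injective hd
  exact ⟨δ₁ * δ₂⁻¹, by rw [mul_smul, inv_smul_smul]⟩

end Shadow

/-! ### Conjugation by `g ∈ Π` on an open normal `U` and on the maximal pro-`l` quotient of `U` -/

section Conj

variable {P : Type u} [Group P] [TopologicalSpace P] [IsTopologicalGroup P] [CompactSpace P]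
  [TotallyDisconnectedSpace P]
variable {U : Subgroup P} [U.Normal] [CompactSpace U]
variable {Q : Type u} [Group Q] [TopologicalSpace Q] [IsTopologicalGroup Q] [CompactSpace Q]
  [TotallyDisconnectedSpace Q] [T2Space Q]
variable {S : Set ℕ} {f : U →* Q}

omit [CompactSpace P] [TotallyDisconnectedSpace P] in
/-- **Conjugation by `g ∈ Π` descends to the maximal pro-`S` quotient of the open normal `U`**, acting on
the "shadows" `f(U ∩ X)`: there is `θ̄ : Q ≅ Q` with `f(U ∩ gXg⁻¹) = θ̄(f(U ∩ X))` for every `X ≤ Π`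
(the kernel of `f` is topologically characteristic in `U`, abc-iut-L3-t4's `map_ker_eq`).
[cite: MochizukiCombGC2007, Thm 1.6(i) p.13] -/
theorem exists_shadow_conj_equiv (hf : IsMaxProSigmaQuotient S f) (g : P) :
    ∃ θ : Q ≃ₜ* Q, ∀ X : Subgroup P,
      ((ConjAct.toConjAct g • X).subgroupOf U).map f =
        (((X.subgroupOf U).map f).map θ.toMulEquiv.toMonoidHom) := by
  -- conjugation by `g` as a topological automorphism of `U`
  have hc : Continuous (MulAut.conjNormal g : U ≃* U) := by
    apply continuous_induced_rng.mpr
    have : Subtype.val ∘ (MulAut.conjNormal g : U ≃* U) = fun u : U => g * (u : P) * g⁻¹ := by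
      funext u; exact MulAut.conjNormal_apply g u
    rw [this]
    exact (continuous_const.mul continuous_subtype_val).mul continuous_const
  have hc' : Continuous (MulAut.conjNormal g : U ≃* U).symm := by
    apply continuous_induced_rng.mpr
    have : Subtype.val ∘ (MulAut.conjNormal g : U ≃* U).symm = fun u : U => g⁻¹ * (u : P) * g := by
      funext u; exact MulAut.conjNormal_symm_apply g u
    rw [this]
    exact (continuous_const.mul continuous_subtype_val).mul continuous_const
  let θU : U ≃ₜ* U :=
    { (MulAut.conjNormal g : U ≃* U) with
      continuous_toFun := hc
      continuous_invFun := hc' }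
  have hθU : ∀ u : U, ((θU u : U) : P) = g * u * g⁻¹ := fun u => MulAut.conjNormal_apply g u
  obtain ⟨θ, hθ⟩ := exists_over_of_ker_map_eq θU hf.continuous hf.surjective hf.continuous hf.surjective
    (hf.map_ker_eq hf θU)
  refine ⟨θ, fun X => ?_⟩
  have hX : (ConjAct.toConjAct g • X).subgroupOf U = (X.subgroupOf U).map θU.toMulEquiv.toMonoidHom := by
    ext u
    simp only [Subgroup.mem_subgroupOf, Subgroup.mem_map, Subgroup.mem_pointwise_smul_iff_inv_smul_mem]
    constructor
    · intro hu
      refine ⟨θU.symm u, ?_, θU.apply_symm_apply u⟩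
      have e : ((θU.symm u : U) : P) = g⁻¹ * u * g := MulAut.conjNormal_symm_apply g u
      rw [e]
      simpa [ConjAct.smul_def, mul_assoc] using hu
    · rintro ⟨v, hv, rfl⟩
      change (ConjAct.toConjAct g)⁻¹ • ((θU v : U) : P) ∈ X
      rw [hθU]
      simpa [ConjAct.smul_def, mul_assoc] using hv
  rw [hX, map_map_eq_of_over hθ]

end Conj

/-! ### The level step: `α(U ⊔ C) = α(U) ⊔ B'` from the pro-`l` shadows -/

section Level

variable {P : Type u} [Group P] [TopologicalSpace P] [IsTopologicalGroup P] [CompactSpace P]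
  [TotallyDisconnectedSpace P]
variable (G : PSCDatum P)
variable {U : Subgroup P} [U.Normal] [U.FiniteIndex] [CompactSpace U]
variable {Q : Type u} [Group Q] [TopologicalSpace Q] [IsTopologicalGroup Q] [CompactSpace Q]
  [TotallyDisconnectedSpace Q] [T2Space Q]
variable {l : ℕ} {f : U →* Q}

omit [IsTopologicalGroup P] [CompactSpace P] [TotallyDisconnectedSpace P] [U.Normal] [U.FiniteIndex]
  [CompactSpace U] [IsTopologicalGroup Q] [CompactSpace Q] [TotallyDisconnectedSpace Q] [T2Space Q] in
variable {G} in
/-- A conjugate of a cuspidal subgroup is cuspidal. [cite: MochizukiCombGC2007, Def 1.1(ii) p.7] -/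
theorem IsCuspidal.conj_smul {C : Subgroup P} (hC : G.IsCuspidal C) (γ : ConjAct P) :
    G.IsCuspidal (γ • C) := by
  obtain ⟨c, γ₀, rfl⟩ := hC
  exact ⟨c, γ * γ₀, (mul_smul γ γ₀ _).symm⟩

omit [TopologicalSpace P] [IsTopologicalGroup P] [CompactSpace P] [TotallyDisconnectedSpace P]
  [U.Normal] [U.FiniteIndex] [CompactSpace U] [TopologicalSpace Q] [IsTopologicalGroup Q] [CompactSpace Q]
  [TotallyDisconnectedSpace Q] [T2Space Q] in
/-- Shadows of `U`-conjugates: `f(U ∩ uCu⁻¹) = f(u) f(U ∩ C) f(u)⁻¹` for `u ∈ U`.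
[cite: MochizukiCombGC2007, Thm 1.6(i) p.13] -/
theorem shadow_smul_of_mem (C : Subgroup P) (u : U) :
    ((ConjAct.toConjAct (u : P) • C).subgroupOf U).map f =
      ConjAct.toConjAct (f u) • (C.subgroupOf U).map f := by
  rw [← conj_subgroupOf_eq C u, map_conj_smul, ConjAct.ofConjAct_toConjAct]

omit [CompactSpace P] [TotallyDisconnectedSpace P] [IsTopologicalGroup Q] [CompactSpace Q]
  [TotallyDisconnectedSpace Q] in
/-- **The stabilizer of a cusp of `G_U` is read on the pro-`l` shadows** ([CombGC] p. 13: "by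
Proposition 1.2, (ii), cuspidal edge-like subgroups may be recovered as the stabilizers of cusps of
finite étale coverings … we may assume `Σ = {l}`"): for `C` cuspidal in `Π_G` and `g ∈ Π_G`,
`g ∈ U·C` iff the shadow `f(U ∩ gCg⁻¹)` is `Q`-conjugate to `f(U ∩ C)` — granting Prop. 1.2 (ii) for
`G` and Prop. 1.2 (i) for the pro-`l` covering datum. [cite: MochizukiCombGC2007, Thm 1.6(i) p.13] -/
theorem mem_sup_iff_shadow_conj (hU : IsOpen (U : Set P)) (bd : G.BranchData) (hl : l ∈ G.Sigma)
    (hf : IsMaxProSigmaQuotient {l} f) (hct : G.VerticialEdgeLikeCommensurablyTerminal)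
    (hD : ((G.restrictBD U hU bd).mapAlong f hf.continuous {l}
      (Set.singleton_subset_iff.mpr hl) (Set.singleton_nonempty l) hf.proSigma).EdgeLikeOpenInterDeterminesEdge)
    {C : Subgroup P} (hC : G.IsCuspidal C) (g : P) :
    g ∈ U ⊔ C ↔ ∃ q : ConjAct Q,
      ((ConjAct.toConjAct g • C).subgroupOf U).map f = q • (C.subgroupOf U).map f := by
  constructor
  · intro hg
    have hg' : g ∈ ((U ⊔ C : Subgroup P) : Set P) := hg
    rw [Subgroup.normal_mul] at hg'
    obtain ⟨u, hu, c, hc, rfl⟩ := Set.mem_mul.mp hg'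
    refine ⟨ConjAct.toConjAct (f ⟨u, hu⟩), ?_⟩
    rw [map_mul, mul_smul, conjAct_smul_eq_self_of_mem hc]
    exact shadow_smul_of_mem C ⟨u, hu⟩
  · rintro ⟨q, hq⟩
    -- the shadows determine the traces up to `U`-conjugacy (Prop. 1.2 (i) for the pro-`l` datum)
    have h₁ : (G.restrictBD U hU bd).IsCuspidal ((ConjAct.toConjAct g • C).subgroupOf U) :=
      (isCuspidal_restrictBD_iff' hU bd _).mpr ⟨_, hC.conj_smul _, rfl⟩
    have h₂ : (G.restrictBD U hU bd).IsCuspidal (C.subgroupOf U) :=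
      (isCuspidal_restrictBD_iff' hU bd _).mpr ⟨C, hC, rfl⟩
    obtain ⟨δ, hδ⟩ := exists_smul_eq_of_map_conj (G.restrictBD U hU bd) f hf.continuous {l}
      (Set.singleton_subset_iff.mpr hl) (Set.singleton_nonempty l) hf.proSigma hD h₁ h₂ hq
    -- hence the traces on `U` of `gCg⁻¹` and `uCu⁻¹` agree, `u := δ ∈ U`
    set u : U := ConjAct.ofConjAct δ with hu
    have hδu : δ = ConjAct.toConjAct u := by rw [hu, ConjAct.toConjAct_ofConjAct]
    rw [hδu, conj_subgroupOf_eq] at hδ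
    have htr : U ⊓ ConjAct.toConjAct (u : P) • C = U ⊓ ConjAct.toConjAct g • C := by
      rw [inf_comm, inf_comm U, ← Subgroup.subgroupOf_map_subtype, ← Subgroup.subgroupOf_map_subtype, hδ]
    -- Prop. 1.2 (ii): equal traces of commensurably terminal subgroups ⇒ equal subgroups
    have hA : Subgroup.Commensurable.commensurator (ConjAct.toConjAct (u : P) • C) =
        ConjAct.toConjAct (u : P) • C :=
      hct _ (Or.inr (Or.inr (hC.conj_smul _)))
    have hB : Subgroup.Commensurable.commensurator (ConjAct.toConjAct g • C) = ConjAct.toConjAct g • C :=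
      hct _ (Or.inr (Or.inr (hC.conj_smul _)))
    have heq : ConjAct.toConjAct (u : P) • C = ConjAct.toConjAct g • C := by
      have := map_eq_of_map_inf_eq (MulEquiv.refl P) (U := U) hA hB (by
        change Subgroup.map (MonoidHom.id P) _ = Subgroup.map (MonoidHom.id P) U ⊓ _
        rw [Subgroup.map_id, Subgroup.map_id, htr])
      simpa using this
    -- `u⁻¹ g` normalises `C`, hence lies in `C` (commensurable terminality)
    have hng : ConjAct.toConjAct ((u : P)⁻¹ * g) • C = C := by
      rw [map_mul, mul_smul, ← heq, smul_smul, map_inv, inv_mul_cancel, one_smul]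
    have hmem : (u : P)⁻¹ * g ∈ Subgroup.Commensurable.commensurator C := by
      rw [Subgroup.Commensurable.commensurator_mem_iff, hng]
    rw [hct C (Or.inr (Or.inr hC))] at hmem
    have : g = (u : P) * ((u : P)⁻¹ * g) := by group
    rw [this]
    exact Subgroup.mul_mem_sup u.2 hmem

end Level

end PSCDatum

end Literature.AnabelianGeometry.SemiGraphs

end
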